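import Summits.AtomisticToContinuum.BoseEinsteinCondensation.Theorems.BECCutLineWeakDisorderTwoReplicaTransienceBoundSliceMoment
import HarnessLib

/-!
# Crux `TwoReplicaTransienceBound` (stmt-AtomisticToContinuum-9687): the SCALE-COVARIANT per-slice
# cubic Wiener-sausage moment (slice length `h = τ²`)

Support file (does not close the item) for the crux
`Summit.AtomisticToContinuum.BoseEinsteinCondensation.Theses.BECCutLineWeakDisorder.TwoReplicaTransienceBound`
(route `BECCutLineWeakDisorder`, line `SketchIdeator1`, skeleton v7, lead c4): the registered toolbox stub
`stub_sliceMomentCubic` of the time-sliced insertion recursion (kinetic window).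

The landed `stub_sliceMoment` (module `…SliceMoment`) bounds the cubic moment of the covering radius
`2(R + √2(S(ω₀) + S(ω)))`, `S(ω) = Σ_{c<3} incRunSup u h (ω c)`, INHOMOGENEOUSLY (`y³ ≤ 1 + y⁴`) by
`1 + 128 R⁴ + const · h²`. Here we prove the scale-covariant version at slice length `h = τ²`:

  `∫∫ ofReal ((2(R + √2(S(ω₀) + S(ω))))³) d wienerLine d wienerLine ≤ ofReal (32 R³ + 228096 τ³)`,

uniformly in the slice start `u`, which is what the physically sharp (Spitzer) kinetic window
`{ρR³ ≤ c₁, ρRT ≤ c₂}` needs. Everything is elementary on top of the two moment bounds already in the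
tree:

* `SliceMomentCubic.sausage_cube_le_cubic` — `(2(R + √2(a + b)))³ ≤ 32 R³ + 384 (a³ + b³)` for
  `R, a, b ≥ 0` (`(x + y)³ ≤ 4(x³ + y³)` twice, `(√2)³ = 2√2`, `√2 ≤ 3/2`);
* `SliceMomentCubic.sum_incRunSup_pow_three_le` — `(Σ_{c<3} M_c)³ ≤ 9 Σ_c M_c³` (power mean), whence
  the pointwise bound `ofReal (cube) ≤ ofReal (32R³) + 3456 Σ_c ofReal (M_c(ω₀)³) + 3456 Σ_c ofReal (M_c(ω)³)`
  (`SliceMomentCubic.ofReal_slice_cube_le_cubic`, `384 · 9 = 3456`);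
* `SliceMomentCubic.lintegral_incRunSup_pow_three_le` — **`E[(incRunSup u τ²)³] ≤ 11 τ³`** WITHOUT
  square roots: integrate the pointwise `2τ M³ ≤ τ² M² + M⁴` against `E[M²] ≤ 4τ²`
  (`Literature.Probability.Process.lintegral_incRunSup_sq_le`, Doob `L²`) and `E[M⁴] ≤ 18 τ⁴`
  (`SliceMoment.lintegral_incRunSup_pow_four_le`), and cancel `ofReal (2τ)` (`τ > 0`);
* `SliceMomentCubic.lintegral_slice_cube_le_cubic` and the registered
  `TracerDecoupling.stub_sliceMomentCubic` — bookkeeping of the double integral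
  (`SausageMoment.lintegral_lintegral_le_of_le_add`: `A + 2B` with `A = ofReal (32R³)`,
  `B = 3456 · 3 · ofReal (11 τ³)`, `2 · 3456 · 3 · 11 = 228096`).

No sharp constant is claimed. Deliberately NOT here: the kinetic window itself (lead's glue).
-/

noncomputable section

open MeasureTheory Set
open scoped ENNReal NNReal BigOperators

namespace Summit.AtomisticToContinuum.BoseEinsteinCondensation.Cruxes.TwoReplicaTransienceBound.TracerDecoupling.SliceMomentCubic

open Literature.Probability.Process (incRunSup preWienerMeasure measurable_incRunSup' incRunSup_nonneg
  lintegral_incRunSup_sq_le)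

/-! ### Elementary real inequalities -/

/-- `(x + y)³ ≤ 4 (x³ + y³)` for `x, y ≥ 0` (`4(x³ + y³) − (x + y)³ = 3(x + y)(x − y)²`). [folklore] -/
theorem add_pow_three_le (x y : ℝ) (hx : 0 ≤ x) (hy : 0 ≤ y) :
    (x + y) ^ 3 ≤ 4 * (x ^ 3 + y ^ 3) := by
  nlinarith [mul_nonneg (add_nonneg hx hy) (sq_nonneg (x - y))]

/-- **The elementary scale-covariant cube bound**: for `R, a, b ≥ 0`,
`(2(R + √2(a + b)))³ ≤ 32 R³ + 384 (a³ + b³)`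
(`(x + y)³ ≤ 4(x³ + y³)` twice, `(√2)³ = 2√2`, `√2 ≤ 3/2`: `8 · 4 · 2√2 · 4 = 256√2 ≤ 384`). [folklore] -/
theorem sausage_cube_le_cubic (R a b : ℝ) (hR : 0 ≤ R) (ha : 0 ≤ a) (hb : 0 ≤ b) :
    (2 * (R + Real.sqrt 2 * (a + b))) ^ 3 ≤ 32 * R ^ 3 + 384 * (a ^ 3 + b ^ 3) := by
  have h2 : Real.sqrt 2 ^ 2 = 2 := Real.sq_sqrt (by norm_num)
  have h0 : 0 ≤ Real.sqrt 2 := Real.sqrt_nonneg 2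
  have h32 : Real.sqrt 2 ≤ 3 / 2 := Real.sqrt_le_iff.2 ⟨by norm_num, by norm_num⟩
  have hs : 0 ≤ a + b := add_nonneg ha hb
  have h1 : (R + Real.sqrt 2 * (a + b)) ^ 3 ≤ 4 * (R ^ 3 + (Real.sqrt 2 * (a + b)) ^ 3) :=
    add_pow_three_le R _ hR (mul_nonneg h0 hs)
  have h3 : (a + b) ^ 3 ≤ 4 * (a ^ 3 + b ^ 3) := add_pow_three_le a b ha hb
  have hab3 : 0 ≤ a ^ 3 + b ^ 3 := add_nonneg (pow_nonneg ha 3) (pow_nonneg hb 3)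
  have hcube : Real.sqrt 2 ^ 3 = 2 * Real.sqrt 2 := by rw [pow_succ, h2]
  calc (2 * (R + Real.sqrt 2 * (a + b))) ^ 3 = 8 * (R + Real.sqrt 2 * (a + b)) ^ 3 := by ring
    _ ≤ 8 * (4 * (R ^ 3 + (Real.sqrt 2 * (a + b)) ^ 3)) := by gcongr
    _ = 32 * R ^ 3 + 64 * Real.sqrt 2 * (a + b) ^ 3 := by rw [mul_pow, hcube]; ring
    _ ≤ 32 * R ^ 3 + 64 * Real.sqrt 2 * (4 * (a ^ 3 + b ^ 3)) := by gcongr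
    _ ≤ 32 * R ^ 3 + 64 * (3 / 2) * (4 * (a ^ 3 + b ^ 3)) := by gcongr
    _ = 32 * R ^ 3 + 384 * (a ^ 3 + b ^ 3) := by ring

/-- `2 t M³ ≤ t² M² + M⁴` for all reals (`t² M² + M⁴ − 2 t M³ = (M(t − M))² ≥ 0`): the square-root-free
route from the second and fourth moments to the third. [folklore] -/
theorem two_mul_mul_pow_three_le (t M : ℝ) : 2 * t * M ^ 3 ≤ t ^ 2 * M ^ 2 + M ^ 4 := by
  nlinarith [sq_nonneg (M * (t - M))]

/-! ### The pointwise bound of the integrand -/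

/-- **Power mean over the three coordinates**:
`(Σ_{c<3} incRunSup u h (ω c))³ ≤ 9 Σ_c incRunSup u h (ω c)³`
(`pow_sum_le_card_mul_sum_pow`, the summands being nonnegative). [folklore] -/
theorem sum_incRunSup_pow_three_le (u h : ℝ≥0) (ω : Fin 3 → (ℝ≥0 → ℝ)) :
    (∑ c, incRunSup u h (ω c)) ^ 3 ≤ 9 * ∑ c, incRunSup u h (ω c) ^ 3 := by
  calc (∑ c, incRunSup u h (ω c)) ^ 3
      ≤ ((Finset.univ : Finset (Fin 3)).card : ℝ) ^ 2 * ∑ c, incRunSup u h (ω c) ^ 3 :=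
        pow_sum_le_card_mul_sum_pow (s := Finset.univ) (f := fun c : Fin 3 => incRunSup u h (ω c))
          (fun c _ => incRunSup_nonneg u h (ω c)) 2
    _ = 9 * ∑ c, incRunSup u h (ω c) ^ 3 := by norm_num [Finset.card_univ, Fintype.card_fin]

/-- **Pointwise bound of the sliced sausage integrand** by a constant plus the third-moment
functionals of the two lines: for `R ≥ 0`,
`ofReal ((2(R + √2(S(ω₀) + S(ω))))³) ≤ ofReal (32R³) + 3456 Σ_c ofReal (M_c(ω₀)³) + 3456 Σ_c ofReal (M_c(ω)³)`,
`M_c(ω) = incRunSup u h (ω c) ≥ 0`, `S = Σ_c M_c` (`sausage_cube_le_cubic`, `sum_incRunSup_pow_three_le`,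
`384 · 9 = 3456`). [folklore] -/
theorem ofReal_slice_cube_le_cubic (R : ℝ) (hR : 0 ≤ R) (u h : ℝ≥0) (ω₀ ω : Fin 3 → (ℝ≥0 → ℝ)) :
    ENNReal.ofReal ((2 * (R + Real.sqrt 2 *
        ((∑ c, incRunSup u h (ω₀ c)) + ∑ c, incRunSup u h (ω c)))) ^ 3) ≤
      ENNReal.ofReal (32 * R ^ 3) + 3456 * ∑ c, ENNReal.ofReal (incRunSup u h (ω₀ c) ^ 3) +
        3456 * ∑ c, ENNReal.ofReal (incRunSup u h (ω c) ^ 3) := by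
  have h3a : 0 ≤ ∑ c, incRunSup u h (ω₀ c) ^ 3 :=
    Finset.sum_nonneg fun c _ => pow_nonneg (incRunSup_nonneg u h (ω₀ c)) 3
  have h3b : 0 ≤ ∑ c, incRunSup u h (ω c) ^ 3 :=
    Finset.sum_nonneg fun c _ => pow_nonneg (incRunSup_nonneg u h (ω c)) 3
  have hR3 : 0 ≤ 32 * R ^ 3 := by positivity
  have ha : 0 ≤ ∑ c, incRunSup u h (ω₀ c) := Finset.sum_nonneg fun c _ => incRunSup_nonneg u h (ω₀ c)
  have hb : 0 ≤ ∑ c, incRunSup u h (ω c) := Finset.sum_nonneg fun c _ => incRunSup_nonneg u h (ω c)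
  have h1 := sausage_cube_le_cubic R _ _ hR ha hb
  have h2 := sum_incRunSup_pow_three_le u h ω₀
  have h3 := sum_incRunSup_pow_three_le u h ω
  calc ENNReal.ofReal ((2 * (R + Real.sqrt 2 *
          ((∑ c, incRunSup u h (ω₀ c)) + ∑ c, incRunSup u h (ω c)))) ^ 3)
      ≤ ENNReal.ofReal (32 * R ^ 3 + 3456 * (∑ c, incRunSup u h (ω₀ c) ^ 3) +
          3456 * ∑ c, incRunSup u h (ω c) ^ 3) := ENNReal.ofReal_le_ofReal (by linarith)
    _ = ENNReal.ofReal (32 * R ^ 3) + 3456 * ∑ c, ENNReal.ofReal (incRunSup u h (ω₀ c) ^ 3) +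
          3456 * ∑ c, ENNReal.ofReal (incRunSup u h (ω c) ^ 3) := by
        rw [ENNReal.ofReal_add (add_nonneg hR3 (mul_nonneg (by norm_num) h3a))
            (mul_nonneg (by norm_num) h3b),
          ENNReal.ofReal_add hR3 (mul_nonneg (by norm_num) h3a),
          ENNReal.ofReal_mul (by norm_num : (0 : ℝ) ≤ 3456),
          ENNReal.ofReal_mul (by norm_num : (0 : ℝ) ≤ 3456),
          ENNReal.ofReal_sum_of_nonneg (fun c _ => pow_nonneg (incRunSup_nonneg u h (ω₀ c)) 3),
          ENNReal.ofReal_sum_of_nonneg (fun c _ => pow_nonneg (incRunSup_nonneg u h (ω c)) 3)]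
        norm_num

/-! ### The third moment of the running supremum of the increments, slice length `τ²` -/

/-- **`E[(incRunSup u τ²)³] ≤ 11 τ³`** for `τ > 0`, uniformly in the start `u`, WITHOUT square roots:
integrate the pointwise `2τ M³ ≤ τ² M² + M⁴` (`two_mul_mul_pow_three_le`) against
`E[M²] ≤ 4 τ²` (`lintegral_incRunSup_sq_le`, Doob `L²`) and `E[M⁴] ≤ 18 τ⁴`
(`SliceMoment.lintegral_incRunSup_pow_four_le`): `ofReal (2τ) · E[M³] ≤ ofReal (22 τ⁴) = ofReal (2τ) · ofReal (11 τ³)`,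
then cancel `ofReal (2τ) ∉ {0, ⊤}`. [folklore] -/
theorem lintegral_incRunSup_pow_three_le (u τ : ℝ≥0) (hτ : 0 < τ) :
    ∫⁻ ω, ENNReal.ofReal (incRunSup u (τ ^ 2) ω ^ 3) ∂preWienerMeasure ≤
      ENNReal.ofReal (11 * (τ : ℝ) ^ 3) := by
  have hτ0 : (0 : ℝ) < τ := NNReal.coe_pos.2 hτ
  have hmeas3 : Measurable fun ω : ℝ≥0 → ℝ => ENNReal.ofReal (incRunSup u (τ ^ 2) ω ^ 3) :=
    ENNReal.measurable_ofReal.comp ((measurable_incRunSup' u (τ ^ 2)).pow_const 3)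
  have hmeas2 : Measurable fun ω : ℝ≥0 → ℝ => ENNReal.ofReal (incRunSup u (τ ^ 2) ω ^ 2) :=
    ENNReal.measurable_ofReal.comp ((measurable_incRunSup' u (τ ^ 2)).pow_const 2)
  have hmeas4 : Measurable fun ω : ℝ≥0 → ℝ => ENNReal.ofReal (incRunSup u (τ ^ 2) ω ^ 4) :=
    ENNReal.measurable_ofReal.comp ((measurable_incRunSup' u (τ ^ 2)).pow_const 4)
  have h2τ0 : ENNReal.ofReal (2 * τ) ≠ 0 := ENNReal.ofReal_ne_zero_iff.2 (by positivity)
  have h2τtop : ENNReal.ofReal (2 * τ) ≠ ⊤ := ENNReal.ofReal_ne_top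
  have hcoe : ((τ ^ 2 : ℝ≥0) : ℝ) = (τ : ℝ) ^ 2 := NNReal.coe_pow τ 2
  have hsq := lintegral_incRunSup_sq_le u (τ ^ 2)
  have h4 := SliceMoment.lintegral_incRunSup_pow_four_le u (τ ^ 2)
  rw [hcoe] at hsq h4
  refine (ENNReal.mul_le_mul_iff_right h2τ0 h2τtop).1 ?_
  have hpt : ∀ ω : ℝ≥0 → ℝ,
      ENNReal.ofReal ((τ : ℝ) ^ 2 * incRunSup u (τ ^ 2) ω ^ 2 + incRunSup u (τ ^ 2) ω ^ 4) =
        ENNReal.ofReal ((τ : ℝ) ^ 2) * ENNReal.ofReal (incRunSup u (τ ^ 2) ω ^ 2) +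
          ENNReal.ofReal (incRunSup u (τ ^ 2) ω ^ 4) := fun ω => by
    rw [ENNReal.ofReal_add (by positivity) (by positivity), ENNReal.ofReal_mul (by positivity)]
  calc ENNReal.ofReal (2 * τ) * ∫⁻ ω, ENNReal.ofReal (incRunSup u (τ ^ 2) ω ^ 3) ∂preWienerMeasure
      = ∫⁻ ω, ENNReal.ofReal (2 * τ * incRunSup u (τ ^ 2) ω ^ 3) ∂preWienerMeasure := by
        rw [← lintegral_const_mul _ hmeas3]
        refine lintegral_congr fun ω => ?_
        rw [← ENNReal.ofReal_mul (by positivity : (0 : ℝ) ≤ 2 * τ)]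
    _ ≤ ∫⁻ ω, ENNReal.ofReal ((τ : ℝ) ^ 2 * incRunSup u (τ ^ 2) ω ^ 2 + incRunSup u (τ ^ 2) ω ^ 4)
          ∂preWienerMeasure :=
        lintegral_mono fun ω => ENNReal.ofReal_le_ofReal (two_mul_mul_pow_three_le _ _)
    _ = ENNReal.ofReal ((τ : ℝ) ^ 2) * ∫⁻ ω, ENNReal.ofReal (incRunSup u (τ ^ 2) ω ^ 2) ∂preWienerMeasure +
          ∫⁻ ω, ENNReal.ofReal (incRunSup u (τ ^ 2) ω ^ 4) ∂preWienerMeasure := by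
        simp_rw [hpt]
        rw [lintegral_add_right _ hmeas4, lintegral_const_mul _ hmeas2]
    _ ≤ ENNReal.ofReal ((τ : ℝ) ^ 2) * (4 * ENNReal.ofReal ((τ : ℝ) ^ 2)) +
          ENNReal.ofReal (18 * ((τ : ℝ) ^ 2) ^ 2) := by
        gcongr
    _ = ENNReal.ofReal (2 * τ) * ENNReal.ofReal (11 * (τ : ℝ) ^ 3) := by
        rw [← ENNReal.ofReal_ofNat 4, ← ENNReal.ofReal_mul (by norm_num),
          ← ENNReal.ofReal_mul (by positivity), ← ENNReal.ofReal_add (by positivity) (by positivity),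
          ← ENNReal.ofReal_mul (by positivity)]
        congr 1
        ring

/-! ### Integration: marginals and the third moment -/

/-- The third-moment functional `ω ↦ 3456 Σ_c ofReal (incRunSup u h (ω c)³)` of one line is
measurable (`measurable_incRunSup'`, `measurable_pi_apply`). [folklore] -/
theorem measurable_sliceCubicFunctional (u h : ℝ≥0) :
    Measurable fun ω : Fin 3 → (ℝ≥0 → ℝ) =>
      (3456 : ℝ≥0∞) * ∑ c, ENNReal.ofReal (incRunSup u h (ω c) ^ 3) := by
  have hm : Measurable fun ω : Fin 3 → (ℝ≥0 → ℝ) =>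
      (3456 : ℝ≥0∞) * ∑ c, ENNReal.ofReal (incRunSup u h (ω c) ^ 3) :=
    (Finset.measurable_sum (Finset.univ : Finset (Fin 3)) fun c _ =>
      ENNReal.measurable_ofReal.comp
        (((measurable_incRunSup' u h).comp (measurable_pi_apply c)).pow_const 3)).const_mul _
  exact hm

/-- **One-coordinate marginal**: under `wienerLine = ⨂_{c<3} preWienerMeasure` each coordinate
`ω c` has the pre-Wiener law (`MeasureTheory.measurePreserving_eval`), so
`∫ ofReal (incRunSup u τ² (ω c)³) d wienerLine ≤ ofReal (11 τ³)` (`lintegral_incRunSup_pow_three_le`).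
[folklore] -/
theorem lintegral_incRunSup_apply_pow_three_le (u τ : ℝ≥0) (hτ : 0 < τ) (c : Fin 3) :
    ∫⁻ ω, ENNReal.ofReal (incRunSup u (τ ^ 2) (ω c) ^ 3) ∂wienerLine ≤
      ENNReal.ofReal (11 * (τ : ℝ) ^ 3) := by
  haveI := Literature.Probability.RandomPlanarGeometry.isProbabilityMeasure_preWienerMeasure'
  have hmp : MeasurePreserving (Function.eval c) wienerLine preWienerMeasure :=
    measurePreserving_eval (fun _ : Fin 3 => preWienerMeasure) c
  have hmeas : Measurable fun η : ℝ≥0 → ℝ => ENNReal.ofReal (incRunSup u (τ ^ 2) η ^ 3) :=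
    ENNReal.measurable_ofReal.comp ((measurable_incRunSup' u (τ ^ 2)).pow_const 3)
  calc ∫⁻ ω, ENNReal.ofReal (incRunSup u (τ ^ 2) (ω c) ^ 3) ∂wienerLine
      = ∫⁻ η, ENNReal.ofReal (incRunSup u (τ ^ 2) η ^ 3) ∂preWienerMeasure := hmp.lintegral_comp hmeas
    _ ≤ ENNReal.ofReal (11 * (τ : ℝ) ^ 3) := lintegral_incRunSup_pow_three_le u τ hτ

/-- **The third-moment functional integrates to at most `3456 · 3 · ofReal (11 τ³)`**
(`lintegral_const_mul`, `lintegral_finsetSum`, three marginals). [folklore] -/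
theorem lintegral_sliceCubicFunctional_le (u τ : ℝ≥0) (hτ : 0 < τ) :
    ∫⁻ ω, (3456 : ℝ≥0∞) * ∑ c, ENNReal.ofReal (incRunSup u (τ ^ 2) (ω c) ^ 3) ∂wienerLine ≤
      3456 * (3 * ENNReal.ofReal (11 * (τ : ℝ) ^ 3)) := by
  have hmk : ∀ c : Fin 3,
      Measurable fun ω : Fin 3 → (ℝ≥0 → ℝ) => ENNReal.ofReal (incRunSup u (τ ^ 2) (ω c) ^ 3) :=
    fun c => by
    have hm : Measurable fun ω : Fin 3 → (ℝ≥0 → ℝ) => ENNReal.ofReal (incRunSup u (τ ^ 2) (ω c) ^ 3) :=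
      ENNReal.measurable_ofReal.comp
        (((measurable_incRunSup' u (τ ^ 2)).comp (measurable_pi_apply c)).pow_const 3)
    exact hm
  rw [lintegral_const_mul _ (Finset.measurable_sum _ fun c _ => hmk c),
    lintegral_finsetSum _ fun c _ => hmk c]
  calc (3456 : ℝ≥0∞) * ∑ c, ∫⁻ ω, ENNReal.ofReal (incRunSup u (τ ^ 2) (ω c) ^ 3) ∂wienerLine
      ≤ 3456 * ∑ _c : Fin 3, ENNReal.ofReal (11 * (τ : ℝ) ^ 3) := by
        gcongr with c
        exact lintegral_incRunSup_apply_pow_three_le u τ hτ c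
    _ = 3456 * (3 * ENNReal.ofReal (11 * (τ : ℝ) ^ 3)) := by
        simp only [Finset.sum_const, Finset.card_univ, Fintype.card_fin, nsmul_eq_mul, Nat.cast_ofNat]

/-- **The double integral on the slice `[u, u + τ²]`**:
`∫∫ ofReal ((2(R + √2(S(ω₀) + S(ω))))³) d wienerLine d wienerLine ≤ ofReal (32 R³) + 2 · (3456 · (3 · ofReal (11 τ³)))`
for `R ≥ 0`, `τ > 0`, independent of `u` (`SausageMoment.lintegral_lintegral_le_of_le_add`). [folklore] -/
theorem lintegral_slice_cube_le_cubic (R : ℝ) (hR : 0 ≤ R) (u τ : ℝ≥0) (hτ : 0 < τ) :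
    ∫⁻ ω₀, ∫⁻ ω, ENNReal.ofReal ((2 * (R + Real.sqrt 2 *
        ((∑ c, incRunSup u (τ ^ 2) (ω₀ c)) + ∑ c, incRunSup u (τ ^ 2) (ω c)))) ^ 3)
        ∂wienerLine ∂wienerLine ≤
      ENNReal.ofReal (32 * R ^ 3) + 2 * (3456 * (3 * ENNReal.ofReal (11 * (τ : ℝ) ^ 3))) :=
  SausageMoment.lintegral_lintegral_le_of_le_add wienerLine
    (G := fun ω : Fin 3 → (ℝ≥0 → ℝ) =>
      (3456 : ℝ≥0∞) * ∑ c, ENNReal.ofReal (incRunSup u (τ ^ 2) (ω c) ^ 3))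
    (measurable_sliceCubicFunctional u (τ ^ 2))
    (fun ω₀ ω => ofReal_slice_cube_le_cubic R hR u (τ ^ 2) ω₀ ω)
    (lintegral_sliceCubicFunctional_le u τ hτ)

/-- **The constant**: `ofReal (32 R³) + 2 · (3456 · (3 · ofReal (11 τ³))) = ofReal (32 R³ + 228096 τ³)` for
`R ≥ 0` (`2 · 3456 · 3 · 11 = 228096`; all summands nonnegative, so `ofReal` is additive and
multiplicative). [folklore] -/
theorem sliceCubicConstant_eq (R : ℝ) (hR : 0 ≤ R) (τ : ℝ≥0) :
    ENNReal.ofReal (32 * R ^ 3) + 2 * (3456 * (3 * ENNReal.ofReal (11 * (τ : ℝ) ^ 3))) =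
      ENNReal.ofReal (32 * R ^ 3 + 228096 * (τ : ℝ) ^ 3) := by
  have h : (2 : ℝ≥0∞) * (3456 * (3 * ENNReal.ofReal (11 * (τ : ℝ) ^ 3))) =
      ENNReal.ofReal (228096 * (τ : ℝ) ^ 3) := by
    rw [← ENNReal.ofReal_ofNat 3, ← ENNReal.ofReal_mul (by norm_num), ← ENNReal.ofReal_ofNat 3456,
      ← ENNReal.ofReal_mul (by norm_num), ← ENNReal.ofReal_ofNat 2, ← ENNReal.ofReal_mul (by norm_num)]
    congr 1
    ring
  rw [h, ← ENNReal.ofReal_add (by positivity) (by positivity)]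

end Summit.AtomisticToContinuum.BoseEinsteinCondensation.Cruxes.TwoReplicaTransienceBound.TracerDecoupling.SliceMomentCubic

namespace Summit.AtomisticToContinuum.BoseEinsteinCondensation.Cruxes.TwoReplicaTransienceBound.TracerDecoupling

/-- **Registered toolbox stub `stub_sliceMomentCubic`** (crux stmt-AtomisticToContinuum-9687, line
`SketchIdeator1`, skeleton v7, kinetic window): the SCALE-COVARIANT per-slice cubic Wiener-sausage
moment at slice length `h = τ²`,
`E_{ω₀,ω}[(2(R + √2(S_{u,τ²}(ω₀) + S_{u,τ²}(ω))))³] ≤ ofReal (32 R³ + 228096 τ³)`,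
`S_{u,τ²}(ω) = Σ_{c<3} incRunSup u τ² (ω c)`, for `R ≥ 0`, `τ > 0`, uniformly in the slice start `u`
(`SliceMomentCubic.lintegral_slice_cube_le_cubic`, `SliceMomentCubic.sliceCubicConstant_eq`). The header
below is the registered signature verbatim (one line). -/
theorem stub_sliceMomentCubic : ∀ (R : ℝ), 0 ≤ R → ∀ (τ : NNReal), 0 < τ → ∀ (u : NNReal), ∫⁻ ω₀, ∫⁻ ω, ENNReal.ofReal ((2 * (R + Real.sqrt 2 * ((∑ c, Literature.Probability.Process.incRunSup u (τ ^ 2) (ω₀ c)) + ∑ c, Literature.Probability.Process.incRunSup u (τ ^ 2) (ω c)))) ^ 3) ∂wienerLine ∂wienerLine ≤ ENNReal.ofReal (32 * R ^ 3 + 228096 * (τ : ℝ) ^ 3) :=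
  fun R hR τ hτ u => (SliceMomentCubic.lintegral_slice_cube_le_cubic R hR u τ hτ).trans
    (SliceMomentCubic.sliceCubicConstant_eq R hR τ).le

end Summit.AtomisticToContinuum.BoseEinsteinCondensation.Cruxes.TwoReplicaTransienceBound.TracerDecoupling

end
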